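import Literature.Topology.FourManifolds.TrisectionsSectorNormalForm

/-!
# Stub `stub_tubularZone` of line `lp-by-sphere-system-surgery` for crux `AgkCor6Sufficiency`
(item stmt-SmoothPoincare4-10894, routes CongruenceShadows / GroupTrisection; lead reshape r5)

**The tubular zone of a normal frame** `(u, v, ρ, U, O)` along the compact `F ⊆ X` with
corner-slice charts along `F`: an open `Z`, `F ⊆ Z ⊆ O`, a radius `r > 0` and a jointly smooth
fibrewise translation `A` of the normal coordinates, `(ρ, u, v) : Z ≅ F × D_r`, sub-zones
`{u² + v² < s²}` shrinking to `F`.  Proof: (1) in ONE corner-slice chart the triple `(ρ, u, v)`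
determines the point (the tangential coordinates factor through `ρ`); (2) hence `(ρ, u, v)` is
injective on `{u² + v² < m} ∩ K` for a compact neighbourhood `K ⊆ O` of `F` (pairs of points of `K`
with equal triples form a compact set, pairs in a common chart source are diagonal, on the compact
rest `u² + v²` has no zero, hence a positive lower bound); (3) around each point of `F` the chart
target contains a box `{y₀² + y₁² < ε²} × V` (tube lemma for `(w, p) ↦ w + (p, 0, 0)`); finitely
many boxes cover `F`, `Z` is the union of the pulled-back boxes of radius `r` (`r < ε`, `r² < m`),
saturated under translation of `(y₀, y₁)` in the disc, and `A x p` is THE point of `Z` with triple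
`(ρ x, u x + p₁, v x + p₂)` — in each box `Θ⁻¹ (Θ x + (p, 0, 0))`, whence joint smoothness;
(4) on the compact `K ∖ V` the function `u² + v²` is bounded below.  This file declares the line's
statement `TubularZone` (verbatim from the checked skeleton) and proves the registered stub
`stub_tubularZone`.  References: Gay–Kirby, Geom. Topol. 20 (2016), Def. 1 [GayKirby2016];
Abrams–Gay–Kirby, Geom. Topol. 22 (2018), proof of Thm. 5 [AbramsGayKirby2018]; Douady, Séminaire
H. Cartan 14 (1961/62), exp. 1, §4 [Douady1961].
-/

noncomputable section

-- the prescribed namespace `Summit.<P>.<Sub>.…` duplicates `SmoothPoincare4` (P = Sub)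
set_option linter.dupNamespace false

open Set Function ContinuousMap
open scoped Manifold ContDiff Topology

namespace Summit.SmoothPoincare4.SmoothPoincare4.Cruxes.AgkCor6Sufficiency.LpBySphereSystemSurgery

open Literature.Topology.FourManifolds

/-! ## The statement (verbatim from the skeleton) -/

/-- **Tubular zone of a normal frame** (r5): for a normal frame `(u, v, ρ, U, O)` along a compact
`F` with corner-slice charts along `F`, there are an open `Z` with `F ⊆ Z ⊆ O`, a radius `r > 0`
and a map `A : X → ℝ × ℝ → X` (fibrewise translation of the normal coordinates) such that:
`u² + v² < r²` on `Z`; `(ρ, u, v)` is injective on `Z`; for `x ∈ Z` and `p` with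
`(u x + p₁)² + (v x + p₂)² < r²` the point `A x p` lies in `Z` over the same point `ρ x` of `F` with
normal coordinates `(u x + p₁, v x + p₂)` (so `Z ≅ F × D_r` through `(ρ, u, v)`); `A` is jointly
smooth there; and the sub-zones `{u² + v² < s²}` shrink to `F`.  (Finitely many corner-slice charts
cover `F`; in each, `A` is `y ↦ y + (p, 0, 0)`, chart-independent by `CornerSliceChart.trans_apply`;
injectivity for `r` small by a Lebesgue-number argument.) -/
def TubularZone : Prop :=
  ∀ (X : Type) [TopologicalSpace X] [T2Space X] [SecondCountableTopology X] [CompactSpace X]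
    [ChartedSpace (EuclideanSpace ℝ (Fin 4)) X] [IsManifold (𝓡 4) ∞ X]
    (Ssec F : Set X) (u v : X → ℝ) (ρ : X → X) (U O : Set X) (_ : NormalFrame F u v ρ U O)
    (_ : ∀ x ∈ F, ∃ C : CornerSliceChart Ssec F u v ρ, x ∈ C.Θ.source ∧ C.Θ.source ⊆ O),
    ∃ (Z : Set X) (r : ℝ) (A : X → ℝ × ℝ → X),
      IsOpen Z ∧ F ⊆ Z ∧ Z ⊆ O ∧ 0 < r ∧
      (∀ x ∈ Z, u x ^ 2 + v x ^ 2 < r ^ 2) ∧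
      (∀ x ∈ Z, ∀ y ∈ Z, ρ x = ρ y → u x = u y → v x = v y → x = y) ∧
      (∀ x ∈ Z, ∀ p : ℝ × ℝ, (u x + p.1) ^ 2 + (v x + p.2) ^ 2 < r ^ 2 →
        A x p ∈ Z ∧ ρ (A x p) = ρ x ∧ u (A x p) = u x + p.1 ∧ v (A x p) = v x + p.2) ∧
      ContMDiffOn ((𝓡 4).prod 𝓘(ℝ, ℝ × ℝ)) (𝓡 4) ∞ (fun q : X × (ℝ × ℝ) => A q.1 q.2)
        {q | q.1 ∈ Z ∧ (u q.1 + q.2.1) ^ 2 + (v q.1 + q.2.2) ^ 2 < r ^ 2} ∧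
      (∀ V : Set X, IsOpen V → F ⊆ V →
        ∃ s : ℝ, 0 < s ∧ ∀ x ∈ Z, u x ^ 2 + v x ^ 2 < s ^ 2 → x ∈ V)

/-! ## Helpers -/

namespace TubularZone

/-- The normal displacement vector `(p₁, p₂, 0, 0) ∈ ℝ⁴` attached to `p ∈ ℝ²`. -/
def nrmVec (p : ℝ × ℝ) : EuclideanSpace ℝ (Fin 4) := !₂[p.1, p.2, 0, 0]

/-- Coordinate `0` of `nrmVec p` is `p₁`. -/
@[simp] theorem nrmVec_apply_zero (p : ℝ × ℝ) : nrmVec p 0 = p.1 := rfl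

/-- Coordinate `1` of `nrmVec p` is `p₂`. -/
@[simp] theorem nrmVec_apply_one (p : ℝ × ℝ) : nrmVec p 1 = p.2 := rfl

/-- `nrmVec 0 = 0`. -/
@[simp] theorem nrmVec_zero : nrmVec 0 = 0 := by
  ext i; fin_cases i <;> simp [nrmVec]

/-- Translating by a normal vector does not change the stratum projection. -/
theorem stratumProj_add_nrmVec (y : EuclideanSpace ℝ (Fin 4)) (p : ℝ × ℝ) :
    stratumProj (y + nrmVec p) = stratumProj y := by
  ext i; fin_cases i <;> simp [stratumProj, nrmVec]

/-- A vector is its stratum projection translated by its own normal coordinates. -/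
theorem stratumProj_add_nrmVec_self (y : EuclideanSpace ℝ (Fin 4)) :
    stratumProj y + nrmVec (y 0, y 1) = y := by
  ext i; fin_cases i <;> simp [stratumProj, nrmVec]

/-- `nrmVec` is smooth (it is linear). -/
theorem contDiff_nrmVec : ContDiff ℝ ∞ nrmVec := by
  rw [contDiff_euclidean]
  intro i
  fin_cases i
  · exact contDiff_fst
  · exact contDiff_snd
  · exact contDiff_const
  · exact contDiff_const

/-- A continuous function, positive on a compact set, has a positive lower bound there. -/
theorem exists_pos_forall_le {α : Type*} [TopologicalSpace α] {B : Set α} (hB : IsCompact B)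
    {f : α → ℝ} (hf : Continuous f) (hpos : ∀ y ∈ B, 0 < f y) :
    ∃ m : ℝ, 0 < m ∧ ∀ y ∈ B, m ≤ f y := by
  rcases B.eq_empty_or_nonempty with rfl | hne
  · exact ⟨1, one_pos, fun y hy => hy.elim⟩
  · obtain ⟨y₀, hy₀, hmin⟩ := hB.exists_isMinOn hne hf.continuousOn
    exact ⟨f y₀, hpos y₀ hy₀, fun y hy => isMinOn_iff.1 hmin y hy⟩

variable {M : Type*} [TopologicalSpace M] [ChartedSpace (EuclideanSpace ℝ (Fin 4)) M]
  {S K : Set M} {u v : M → ℝ} {π : M → M} {Ssec F : Set M} {ρ : M → M} {U O : Set M}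

/-- **In one corner-slice chart the triple `(π, u, v)` determines the point**: the normal
coordinates of `Θ` are `u, v` and the tangential ones factor through `π`
(`Θ (π q) = stratumProj (Θ q)`). -/
theorem eq_of_cornerSliceChart (C : CornerSliceChart S K u v π) {x y : M} (hx : x ∈ C.Θ.source)
    (hy : y ∈ C.Θ.source) (hπ : π x = π y) (hu : u x = u y) (hv : v x = v y) : x = y := by
  refine C.Θ.injOn hx hy ?_
  have h2 : ∀ q ∈ C.Θ.source, C.Θ q 2 = C.Θ (π q) 2 ∧ C.Θ q 3 = C.Θ (π q) 3 := fun q hq => by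
    rw [C.apply_π q hq]; exact ⟨rfl, rfl⟩
  ext i
  fin_cases i
  · show C.Θ x 0 = C.Θ y 0
    rw [C.apply_zero x hx, C.apply_zero y hy, hu]
  · show C.Θ x 1 = C.Θ y 1
    rw [C.apply_one x hx, C.apply_one y hy, hv]
  · show C.Θ x 2 = C.Θ y 2
    rw [(h2 x hx).1, (h2 y hy).1, hπ]
  · show C.Θ x 3 = C.Θ y 3
    rw [(h2 x hx).2, (h2 y hy).2, hπ]

/-- **A box in the target of a corner-slice chart**: for `x` in the source and an open `G ∋ x`,
an open `V ∋ Θ x` and `ε > 0` such that every `y` with `y₀² + y₁² < ε²` and `stratumProj y ∈ V`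
lies in the target with `Θ⁻¹ y ∈ G` (tube lemma for `(w, p) ↦ w + (p, 0, 0)` at `(Θ x, 0)`). -/
theorem exists_chartBox (C : CornerSliceChart S K u v π) {x : M} (hx : x ∈ C.Θ.source)
    {G : Set M} (hG : IsOpen G) (hxG : x ∈ G) :
    ∃ (V : Set (EuclideanSpace ℝ (Fin 4))) (ε : ℝ), IsOpen V ∧ 0 < ε ∧ C.Θ x ∈ V ∧
      ∀ y : EuclideanSpace ℝ (Fin 4), y 0 ^ 2 + y 1 ^ 2 < ε ^ 2 → stratumProj y ∈ V →
        y ∈ C.Θ.target ∧ C.Θ.symm y ∈ G := by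
  set T : Set (EuclideanSpace ℝ (Fin 4)) := C.Θ.target ∩ C.Θ.symm ⁻¹' G with hT
  have hTo : IsOpen T := C.Θ.continuousOn_symm.isOpen_inter_preimage C.Θ.open_target hG
  have hxT : C.Θ x ∈ T :=
    ⟨C.Θ.map_source hx, by show C.Θ.symm (C.Θ x) ∈ G; rw [C.Θ.left_inv hx]; exact hxG⟩
  have hcont : Continuous fun q : EuclideanSpace ℝ (Fin 4) × (ℝ × ℝ) => q.1 + nrmVec q.2 :=
    continuous_fst.add (contDiff_nrmVec.continuous.comp continuous_snd)
  have hmem : (fun q : EuclideanSpace ℝ (Fin 4) × (ℝ × ℝ) => q.1 + nrmVec q.2) ⁻¹' T ∈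
      𝓝 (C.Θ x, (0 : ℝ × ℝ)) :=
    hcont.continuousAt.preimage_mem_nhds (by simpa using hTo.mem_nhds hxT)
  obtain ⟨V, D, hVo, hxV, hDo, h0D, hVD⟩ := mem_nhds_prod_iff'.1 hmem
  obtain ⟨ε, hε, hball⟩ := Metric.mem_nhds_iff.1 (hDo.mem_nhds h0D)
  refine ⟨V, ε, hVo, hε, hxV, fun y hy hyV => ?_⟩
  have hyD : (y 0, y 1) ∈ D := by
    apply hball
    rw [mem_ball_zero_iff, Prod.norm_def, Real.norm_eq_abs, Real.norm_eq_abs]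
    have h0 : y 0 ^ 2 < ε ^ 2 := by nlinarith [sq_nonneg (y 1)]
    have h1 : y 1 ^ 2 < ε ^ 2 := by nlinarith [sq_nonneg (y 0)]
    exact max_lt (abs_lt_of_sq_lt_sq h0 hε.le) (abs_lt_of_sq_lt_sq h1 hε.le)
  have h : stratumProj y + nrmVec (y 0, y 1) ∈ T := hVD (mk_mem_prod hyV hyD)
  rw [stratumProj_add_nrmVec_self] at h
  exact h

/-- **`(ρ, u, v)` is injective near `F`**: for a normal frame with corner-slice charts along `F`
and a compact `K ⊆ U`, two points of `K` with the same triple, the first with `u² + v² < m`,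
coincide (pairs with equal triples form a compact set; those in the square of a chart source are
diagonal, `eq_of_cornerSliceChart`; on the compact rest `u² + v²` has no zero, `ρ = id` on `F`). -/
theorem exists_injOn_radius [T2Space M] (hfr : NormalFrame F u v ρ U O)
    (hC : ∀ x ∈ F, ∃ C : CornerSliceChart Ssec F u v ρ, x ∈ C.Θ.source)
    {K : Set M} (hK : IsCompact K) (hKU : K ⊆ U) :
    ∃ m : ℝ, 0 < m ∧ ∀ x ∈ K, ∀ y ∈ K, u x ^ 2 + v x ^ 2 < m →
      ρ x = ρ y → u x = u y → v x = v y → x = y := by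
  have huc : Continuous u := hfr.contMDiff_u.continuous
  have hvc : Continuous v := hfr.contMDiff_v.continuous
  have hρc : Continuous ρ := hfr.contMDiff_ρ.continuous
  choose Cx hCx using hC
  -- pairs of points of `K` with the same triple
  set P : Set (M × M) := K ×ˢ K ∩ ({q | ρ q.1 = ρ q.2} ∩ ({q | u q.1 = u q.2} ∩
    {q : M × M | v q.1 = v q.2})) with hP
  have hPc : IsCompact P :=
    (hK.prod hK).inter_right ((isClosed_eq hρc.fst' hρc.snd').inter
      ((isClosed_eq huc.fst' huc.snd').inter (isClosed_eq hvc.fst' hvc.snd')))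
  -- the squares of the chart sources
  set W : Set (M × M) := ⋃ z : F, (Cx z.1 z.2).Θ.source ×ˢ (Cx z.1 z.2).Θ.source with hW
  have hWo : IsOpen W :=
    isOpen_iUnion fun z => (Cx z.1 z.2).Θ.open_source.prod (Cx z.1 z.2).Θ.open_source
  have hWP : ∀ q ∈ P, q ∈ W → q.1 = q.2 := by
    rintro q ⟨-, hρq, huq, hvq⟩ hqW
    obtain ⟨z, hz⟩ := mem_iUnion.1 hqW
    exact eq_of_cornerSliceChart (Cx z.1 z.2) hz.1 hz.2 hρq huq hvq
  have hpos : ∀ q ∈ P \ W, 0 < u q.1 ^ 2 + v q.1 ^ 2 := by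
    rintro q ⟨⟨⟨hxK, hyK⟩, hρq, huq, hvq⟩, hqW⟩
    by_contra h
    have h' : u q.1 ^ 2 + v q.1 ^ 2 ≤ 0 := not_lt.1 h
    have hu0 : u q.1 = 0 := by nlinarith [sq_nonneg (u q.1), sq_nonneg (v q.1)]
    have hv0 : v q.1 = 0 := by nlinarith [sq_nonneg (u q.1), sq_nonneg (v q.1)]
    have hxF : q.1 ∈ F := (hfr.memF_iff _ (hKU hxK)).2 ⟨hu0, hv0⟩
    have hyF : q.2 ∈ F :=
      (hfr.memF_iff _ (hKU hyK)).2 ⟨by rw [← huq]; exact hu0, by rw [← hvq]; exact hv0⟩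
    have hxy : q.1 = q.2 := by
      rw [← hfr.ρ_eq_self_of_mem hxF, ← hfr.ρ_eq_self_of_mem hyF]; exact hρq
    exact hqW (mem_iUnion.2 ⟨⟨q.1, hxF⟩, hCx _ hxF, by rw [← hxy]; exact hCx _ hxF⟩)
  obtain ⟨m, hm, hmle⟩ :=
    exists_pos_forall_le (hPc.diff hWo) ((huc.fst'.pow 2).add (hvc.fst'.pow 2)) hpos
  refine ⟨m, hm, fun x hx y hy hlt hρ hu hv => ?_⟩
  have hq : (x, y) ∈ P := ⟨⟨hx, hy⟩, hρ, hu, hv⟩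
  by_cases hqW : (x, y) ∈ W
  · exact hWP _ hq hqW
  · exact absurd (hmle _ ⟨hq, hqW⟩) (not_le.2 hlt)

/-- **The sub-zones `{u² + v² < s²}` shrink to `F`**: for a compact `K ⊆ U` and an open `V ⊇ F`,
some `s > 0` has `{x ∈ K | u x² + v x² < s²} ⊆ V` (on the compact `K ∖ V` the function `u² + v²`
has no zero, `F = {u = v = 0}` in `U`). -/
theorem exists_radius_subset (hfr : NormalFrame F u v ρ U O) {K : Set M} (hK : IsCompact K)
    (hKU : K ⊆ U) {V : Set M} (hV : IsOpen V) (hFV : F ⊆ V) :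
    ∃ s : ℝ, 0 < s ∧ ∀ x ∈ K, u x ^ 2 + v x ^ 2 < s ^ 2 → x ∈ V := by
  have huc : Continuous u := hfr.contMDiff_u.continuous
  have hvc : Continuous v := hfr.contMDiff_v.continuous
  have hpos : ∀ y ∈ K \ V, 0 < u y ^ 2 + v y ^ 2 := by
    rintro y ⟨hyK, hyV⟩
    by_contra h
    have h' : u y ^ 2 + v y ^ 2 ≤ 0 := not_lt.1 h
    have hu0 : u y = 0 := by nlinarith [sq_nonneg (u y), sq_nonneg (v y)]
    have hv0 : v y = 0 := by nlinarith [sq_nonneg (u y), sq_nonneg (v y)]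
    exact hyV (hFV ((hfr.memF_iff y (hKU hyK)).2 ⟨hu0, hv0⟩))
  obtain ⟨m, hm, hmle⟩ := exists_pos_forall_le (hK.diff hV) ((huc.pow 2).add (hvc.pow 2)) hpos
  refine ⟨Real.sqrt m, Real.sqrt_pos.2 hm, fun x hx hlt => ?_⟩
  rw [Real.sq_sqrt hm.le] at hlt
  by_contra hxV
  exact absurd (hmle x ⟨hx, hxV⟩) (not_le.2 hlt)

end TubularZone

/-! ## The registered stub -/

open Filter TubularZone in
/-- **Registered stub `stub_tubularZone`**: the tubular zone of a normal frame (see the file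
docstring for the proof). -/
theorem stub_tubularZone : TubularZone := by
  intro X _ _ _ _ _ _ Ssec F u v ρ U O hfr hC
  classical
  haveI : LocallyCompactSpace X := ChartedSpace.locallyCompactSpace (EuclideanSpace ℝ (Fin 4)) X
  have huc : Continuous u := hfr.contMDiff_u.continuous
  have hvc : Continuous v := hfr.contMDiff_v.continuous
  -- ### a compact neighbourhood `K ⊆ O` of `F` and the injectivity constant `m`
  obtain ⟨K, hKc, hFK, hKO⟩ := exists_compact_between hfr.isCompact_F hfr.isOpen_O hfr.F_subset_O
  have hKU : K ⊆ U := hKO.trans hfr.O_subset_U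
  obtain ⟨m, hm, hinj⟩ :=
    exists_injOn_radius hfr (fun x hx => (hC x hx).imp fun C h => h.1) hKc hKU
  choose Cx hCx hCO using hC
  choose V ε hVo hε hzV hVε using
    fun z : F => exists_chartBox (Cx z.1 z.2) (hCx z.1 z.2) isOpen_interior (hFK z.2)
  set N : F → Set X := fun z => (Cx z.1 z.2).Θ.source ∩ (Cx z.1 z.2).Θ ⁻¹' V z with hN
  have hNo : ∀ z, IsOpen (N z) := fun z => (Cx z.1 z.2).Θ.isOpen_inter_preimage (hVo z)
  have hFN : F ⊆ ⋃ z, N z := fun x hx => mem_iUnion.2 ⟨⟨x, hx⟩, hCx x hx, hzV ⟨x, hx⟩⟩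
  obtain ⟨t, ht⟩ := hfr.isCompact_F.elim_finite_subcover N hNo hFN
  obtain ⟨r, hr, hrm, hrε⟩ : ∃ r : ℝ, 0 < r ∧ r ^ 2 < m ∧ ∀ z ∈ t, r < ε z := by
    have h2 : ∀ᶠ r in 𝓝 (0 : ℝ), r ^ 2 < m := by
      have h : Tendsto (fun r : ℝ => r ^ 2) (𝓝 0) (𝓝 0) := by
        simpa using (continuous_pow 2).tendsto (0 : ℝ)
      exact h.eventually_lt_const hm
    have h3 : ∀ᶠ r in 𝓝 (0 : ℝ), ∀ z ∈ t, r < ε z :=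
      (eventually_all_finset t).2 fun z _ => eventually_lt_nhds (hε z)
    exact ((eventually_mem_nhdsWithin (a := (0 : ℝ)) (s := Ioi 0)).and
      ((h2.and h3).filter_mono nhdsWithin_le_nhds)).exists
  -- ### the boxes `{y₀² + y₁² < r²} × V z` and the zone
  set Box : F → Set (EuclideanSpace ℝ (Fin 4)) := fun z =>
    {y | y 0 ^ 2 + y 1 ^ 2 < r ^ 2 ∧ stratumProj y ∈ V z} with hBox
  have hBoxo : ∀ z, IsOpen (Box z) := fun z =>
    (isOpen_lt (((EuclideanSpace.proj (0 : Fin 4)).continuous.pow 2).add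
      ((EuclideanSpace.proj (1 : Fin 4)).continuous.pow 2)) continuous_const).inter
      ((hVo z).preimage continuous_stratumProj)
  have hBoxT : ∀ z ∈ t, ∀ y ∈ Box z,
      y ∈ (Cx z.1 z.2).Θ.target ∧ (Cx z.1 z.2).Θ.symm y ∈ interior K :=
    fun z hz y hy => hVε z y (lt_trans hy.1 (by have := hrε z hz; nlinarith)) hy.2
  set Zx : F → Set X := fun z => (Cx z.1 z.2).Θ.source ∩ (Cx z.1 z.2).Θ ⁻¹' Box z with hZx
  have hZxo : ∀ z, IsOpen (Zx z) := fun z => (Cx z.1 z.2).Θ.isOpen_inter_preimage (hBoxo z)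
  set Z : Set X := ⋃ z ∈ t, Zx z with hZ
  have hZo : IsOpen Z := isOpen_biUnion fun z _ => hZxo z
  have hZxuv : ∀ z ∈ t, ∀ x ∈ Zx z, u x ^ 2 + v x ^ 2 < r ^ 2 := fun z hz x hx => by
    have h : (Cx z.1 z.2).Θ x 0 ^ 2 + (Cx z.1 z.2).Θ x 1 ^ 2 < r ^ 2 := hx.2.1
    rwa [(Cx z.1 z.2).apply_zero x hx.1, (Cx z.1 z.2).apply_one x hx.1] at h
  have hZK : Z ⊆ K := fun x hx => by
    obtain ⟨z, hz, hxz⟩ := mem_iUnion₂.1 hx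
    have h := (hBoxT z hz _ hxz.2).2
    rw [(Cx z.1 z.2).Θ.left_inv hxz.1] at h
    exact interior_subset h
  have hZinj : ∀ x ∈ Z, ∀ y ∈ Z, ρ x = ρ y → u x = u y → v x = v y → x = y := by
    intro x hx y hy hρ hu hv
    obtain ⟨z, hz, hxz⟩ := mem_iUnion₂.1 hx
    exact hinj x (hZK hx) y (hZK hy) (lt_trans (hZxuv z hz x hxz) hrm) hρ hu hv
  -- ### translation inside a box: the chart formula
  have key : ∀ z ∈ t, ∀ x ∈ Zx z, ∀ p : ℝ × ℝ, (u x + p.1) ^ 2 + (v x + p.2) ^ 2 < r ^ 2 →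
      (Cx z.1 z.2).Θ x + nrmVec p ∈ Box z ∧
      (Cx z.1 z.2).Θ.symm ((Cx z.1 z.2).Θ x + nrmVec p) ∈ Zx z ∧
      ρ ((Cx z.1 z.2).Θ.symm ((Cx z.1 z.2).Θ x + nrmVec p)) = ρ x ∧
      u ((Cx z.1 z.2).Θ.symm ((Cx z.1 z.2).Θ x + nrmVec p)) = u x + p.1 ∧
      v ((Cx z.1 z.2).Θ.symm ((Cx z.1 z.2).Θ x + nrmVec p)) = v x + p.2 := by
    intro z hz x hx p hp
    set C := Cx z.1 z.2 with hCdef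
    obtain ⟨hxs, -, hxV⟩ := hx
    have hy0 : (C.Θ x + nrmVec p) 0 = u x + p.1 := by
      rw [PiLp.add_apply, nrmVec_apply_zero, C.apply_zero x hxs]
    have hy1 : (C.Θ x + nrmVec p) 1 = v x + p.2 := by
      rw [PiLp.add_apply, nrmVec_apply_one, C.apply_one x hxs]
    have hyS : stratumProj (C.Θ x + nrmVec p) = stratumProj (C.Θ x) :=
      stratumProj_add_nrmVec _ _
    have hyB : C.Θ x + nrmVec p ∈ Box z := ⟨by rw [hy0, hy1]; exact hp, by rw [hyS]; exact hxV⟩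
    have hyT : C.Θ x + nrmVec p ∈ C.Θ.target := (hBoxT z hz _ hyB).1
    have hq : C.Θ.symm (C.Θ x + nrmVec p) ∈ C.Θ.source := C.Θ.map_target hyT
    have hΘq : C.Θ (C.Θ.symm (C.Θ x + nrmVec p)) = C.Θ x + nrmVec p := C.Θ.right_inv hyT
    refine ⟨hyB, ⟨hq, by show C.Θ (C.Θ.symm (C.Θ x + nrmVec p)) ∈ Box z; rw [hΘq]; exact hyB⟩,
      ?_, ?_, ?_⟩
    · refine C.Θ.injOn (C.mapsTo_π hq) (C.mapsTo_π hxs) ?_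
      rw [C.apply_π _ hq, C.apply_π _ hxs, hΘq, hyS]
    · rw [← C.apply_zero _ hq, hΘq, hy0]
    · rw [← C.apply_one _ hq, hΘq, hy1]
  -- ### the translation map
  set A : X → ℝ × ℝ → X := fun x p =>
    if h : ∃ q, q ∈ Z ∧ ρ q = ρ x ∧ u q = u x + p.1 ∧ v q = v x + p.2 then h.choose else x
    with hA
  have hAeq : ∀ z ∈ t, ∀ x ∈ Zx z, ∀ p : ℝ × ℝ, (u x + p.1) ^ 2 + (v x + p.2) ^ 2 < r ^ 2 →
      A x p = (Cx z.1 z.2).Θ.symm ((Cx z.1 z.2).Θ x + nrmVec p) := by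
    intro z hz x hx p hp
    obtain ⟨-, hqZ, hρq, huq, hvq⟩ := key z hz x hx p hp
    have hqZ' : (Cx z.1 z.2).Θ.symm ((Cx z.1 z.2).Θ x + nrmVec p) ∈ Z :=
      mem_iUnion₂.2 ⟨z, hz, hqZ⟩
    have hex : ∃ q, q ∈ Z ∧ ρ q = ρ x ∧ u q = u x + p.1 ∧ v q = v x + p.2 :=
      ⟨_, hqZ', hρq, huq, hvq⟩
    have hAx : A x p = hex.choose := dif_pos hex
    obtain ⟨h1, h2, h3, h4⟩ := hex.choose_spec
    rw [hAx]
    exact hZinj _ h1 _ hqZ' (h2.trans hρq.symm) (h3.trans huq.symm) (h4.trans hvq.symm)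
  refine ⟨Z, r, A, hZo, ?_, ?_, hr, ?_, hZinj, ?_, ?_, ?_⟩
  · -- `F ⊆ Z`
    intro x hx
    obtain ⟨z, hz, hxN⟩ := mem_iUnion₂.1 (ht hx)
    obtain ⟨hxs, hxV⟩ := hxN
    obtain ⟨hu0, hv0⟩ := (hfr.memF_iff x (hfr.F_subset_U hx)).1 hx
    have hΘx : (Cx z.1 z.2).Θ x = stratumProj ((Cx z.1 z.2).Θ x) :=
      (Cx z.1 z.2).apply_eq_stratumProj_of_mem_K hxs hx
    refine mem_iUnion₂.2 ⟨z, hz, hxs, ?_, by rw [← hΘx]; exact hxV⟩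
    show (Cx z.1 z.2).Θ x 0 ^ 2 + (Cx z.1 z.2).Θ x 1 ^ 2 < r ^ 2
    rw [(Cx z.1 z.2).apply_zero x hxs, (Cx z.1 z.2).apply_one x hxs, hu0, hv0]
    simpa using pow_pos hr 2
  · -- `Z ⊆ O`
    intro x hx
    obtain ⟨z, -, hxz⟩ := mem_iUnion₂.1 hx
    exact hCO z.1 z.2 hxz.1
  · -- `u² + v² < r²` on `Z`
    intro x hx
    obtain ⟨z, hz, hxz⟩ := mem_iUnion₂.1 hx
    exact hZxuv z hz x hxz
  · -- the translation
    intro x hx p hp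
    obtain ⟨z, hz, hxz⟩ := mem_iUnion₂.1 hx
    obtain ⟨-, hqZ, hρq, huq, hvq⟩ := key z hz x hxz p hp
    rw [hAeq z hz x hxz p hp]
    exact ⟨mem_iUnion₂.2 ⟨z, hz, hqZ⟩, hρq, huq, hvq⟩
  · -- joint smoothness: locally `A` is the chart formula
    rintro q ⟨hq1, hq2⟩
    obtain ⟨z, hz, hqz⟩ := mem_iUnion₂.1 hq1
    set C := Cx z.1 z.2 with hCdef
    set D : Set (X × (ℝ × ℝ)) :=
      Prod.fst ⁻¹' Zx z ∩ {q | (u q.1 + q.2.1) ^ 2 + (v q.1 + q.2.2) ^ 2 < r ^ 2} with hD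
    have hDo : IsOpen D := by
      have h : IsOpen {q : X × (ℝ × ℝ) | (u q.1 + q.2.1) ^ 2 + (v q.1 + q.2.2) ^ 2 < r ^ 2} :=
        isOpen_lt (by fun_prop) continuous_const
      exact ((hZxo z).preimage continuous_fst).inter h
    have hqD : q ∈ D := ⟨hqz, hq2⟩
    have hΦ : ContMDiffOn ((𝓡 4).prod 𝓘(ℝ, ℝ × ℝ)) (𝓡 4) ∞
        (fun q : X × (ℝ × ℝ) => C.Θ.symm (C.Θ q.1 + nrmVec q.2)) D := by
      have h1 : ContMDiffOn ((𝓡 4).prod 𝓘(ℝ, ℝ × ℝ)) 𝓘(ℝ, EuclideanSpace ℝ (Fin 4)) ∞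
          (fun q : X × (ℝ × ℝ) => C.Θ q.1) D :=
        C.contMDiffOn_toFun.comp contMDiffOn_fst fun q hq => hq.1.1
      have h2 : ContMDiff ((𝓡 4).prod 𝓘(ℝ, ℝ × ℝ)) 𝓘(ℝ, EuclideanSpace ℝ (Fin 4)) ∞
          fun q : X × (ℝ × ℝ) => nrmVec q.2 :=
        (contMDiff_iff_contDiff.2 contDiff_nrmVec).comp contMDiff_snd
      exact C.contMDiffOn_symm.comp (h1.add h2.contMDiffOn) fun q hq =>
        (hBoxT z hz _ (key z hz q.1 hq.1 q.2 hq.2).1).1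
    have hAΦ : (fun q : X × (ℝ × ℝ) => A q.1 q.2) =ᶠ[𝓝 q]
        fun q : X × (ℝ × ℝ) => C.Θ.symm (C.Θ q.1 + nrmVec q.2) :=
      Filter.eventuallyEq_of_mem (hDo.mem_nhds hqD) fun q hq => hAeq z hz q.1 hq.1 q.2 hq.2
    exact ((hΦ.contMDiffAt (hDo.mem_nhds hqD)).congr_of_eventuallyEq hAΦ).contMDiffWithinAt
  · -- shrinking sub-zones
    intro V' hV' hFV'
    obtain ⟨s, hs, hsub⟩ := exists_radius_subset hfr hKc hKU hV' hFV'
    exact ⟨s, hs, fun x hx hlt => hsub x (hZK hx) hlt⟩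

end Summit.SmoothPoincare4.SmoothPoincare4.Cruxes.AgkCor6Sufficiency.LpBySphereSystemSurgery

end
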